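import Summits.AtomisticToContinuum.HydrodynamicLimit.Theorems.AnnealedZeroHorizonDefs
import Literature.MathematicalPhysics.KineticTheory.HardSphereEulerProofs
import Literature.Analysis.FluidPDE.HardSphereTorusMeasure
import Mathlib

/-!
# Crux `AnnealedWeakStrong` (stmt-AtomisticToContinuum-9258), line `registered` — toolbox A of the
# coercivity-consumption step S3b (`stub_smallRelEntropyFieldsClose`): kernels, a.s. distinct
# velocities, the realizable cone

Generic, currency-independent lemmas of the step "small mean relative entropy ⇒ mollified fields
close in mean" (FjordholmEtAl2020 Lemma 28 transplanted to hard spheres), landed ahead of the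
reshape of that step (the Bochner-in-`x` observable `relEntropyObs` of `AnnealedZeroHorizonDefs` is
junk `0` on configurations whose coarse-grained entropy density is not `x`-integrable, and
`x`-integrability of `x ↦ ρ^k(x) f_ex(ρ^k(x)σ³)` needs local boundedness of `hsExcessFreeEnergy` on
the packing band `[3/(4π), 6/π]` visited by mollified windows, which straddles close packing and is
not available in the tree):

1. every radius `ℓ > 0` carries an admissible mollifier `k ∈ Kernel(ℓ)` (`IsKernel ℓ k`), namely
   the polynomial-decay profile `polyKernel ℓ ∝ (r² − dist(y,0)²)₊`, `r = min (ℓ/2) (1/4)`, with the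
   sup bound `polyKernel ℓ ≤ M⁻¹ r²`;
2. `ae_localGibbsLaw_vel_ne`: under the local Gibbs law, at every time `t` the velocities of the
   flowed configuration are almost surely pairwise distinct (the coincidence set is a finite union
   of Lebesgue-null "hyperplanes", hence Liouville-null, transported by the measure-preserving flow
   map and the absolutely continuous law);
3. the realizable cone of mollified states: for a kernel `0 ≤ k ≤ C`, `U = mollState k z x` has
   `0 ≤ ρ ≤ C`, `0 ≤ E`, `‖m‖² ≤ 2ρE` (weighted Cauchy–Schwarz through the Lagrange identity
   `(Σa)(Σa‖v‖²) − ‖Σav‖² = ½ΣΣ aᵢaⱼ‖vᵢ − vⱼ‖²`), and — off the velocity-coincidence set — the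
   dichotomy "physical (`‖m‖² < 2ρE`) or at most one particle in the window (`ρ ≤ C / n`)".

The registered helper stub `s3bKernelConeToolbox` bundles 1–3. References: FjordholmEtAl2020 (Lemma 28).
-/

noncomputable section

open MeasureTheory Filter Set Function
open scoped ENNReal Topology InnerProductSpace

namespace Summit.AtomisticToContinuum.HydrodynamicLimit.Theorems.AWS

open Literature.MathematicalPhysics.KineticTheory Literature.Analysis.FluidPDE

/-! ### 1. Admissible kernels with polynomial boundary decay -/

/-- Radius of the polynomial kernel at nominal radius `ℓ`: `r = min (ℓ/2) (1/4)`. -/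
def polyRadius (ℓ : ℝ) : ℝ := min (ℓ / 2) (1 / 4)

/-- The un-normalised polynomial profile `(r² − dist(y,0)²)₊`. -/
def polyProfile (ℓ : ℝ) (y : T3) : ℝ := max (polyRadius ℓ ^ 2 - Torus.euclidDist y 0 ^ 2) 0

/-- Its mass `M = ∫ (r² − dist(y,0)²)₊ dy`. -/
def polyMass (ℓ : ℝ) : ℝ := ∫ y, polyProfile ℓ y

/-- **The polynomial kernel** `k(y) = M⁻¹ (r² − dist(y,0)²)₊` (boundary decay linear in the
distance to the edge of the window, so that `log k` is integrable over the window). -/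
def polyKernel (ℓ : ℝ) (y : T3) : ℝ := (polyMass ℓ)⁻¹ * polyProfile ℓ y

/-- The kernel radius is positive for `0 < ℓ`. -/
theorem polyRadius_pos {ℓ : ℝ} (hℓ : 0 < ℓ) : 0 < polyRadius ℓ := lt_min (by linarith) (by norm_num)

/-- The kernel radius is at most `ℓ/2`. -/
theorem polyRadius_le_half (ℓ : ℝ) : polyRadius ℓ ≤ ℓ / 2 := min_le_left _ _

/-- The kernel radius is `< 1/2` (minimal-image balls are Euclidean). -/
theorem polyRadius_lt_half (ℓ : ℝ) : polyRadius ℓ < 1 / 2 := (min_le_right _ _).trans_lt (by norm_num)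

/-- The profile is continuous. -/
theorem continuous_polyProfile (ℓ : ℝ) : Continuous (polyProfile ℓ) := by
  have h : Continuous fun y : T3 => Torus.euclidDist y 0 := by
    simp_rw [euclidDist_eq_sqrt]; fun_prop
  unfold polyProfile
  exact (continuous_const.sub (h.pow 2)).max continuous_const

/-- The profile is non-negative. -/
theorem polyProfile_nonneg (ℓ : ℝ) (y : T3) : 0 ≤ polyProfile ℓ y := le_max_right _ _

/-- The profile is at most `r²`. -/
theorem polyProfile_le (ℓ : ℝ) (y : T3) : polyProfile ℓ y ≤ polyRadius ℓ ^ 2 :=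
  max_le (sub_le_self _ (sq_nonneg _)) (sq_nonneg _)

/-- Off the open `r`-window the profile vanishes (`0 < ℓ`). -/
theorem euclidDist_lt_of_polyProfile_ne_zero {ℓ : ℝ} (hℓ : 0 < ℓ) {y : T3}
    (h : polyProfile ℓ y ≠ 0) : Torus.euclidDist y 0 < polyRadius ℓ := by
  have h' : 0 < polyRadius ℓ ^ 2 - Torus.euclidDist y 0 ^ 2 := by
    by_contra hle
    exact h (max_eq_right (not_lt.1 hle))
  exact lt_of_pow_lt_pow_left₀ 2 (polyRadius_pos hℓ).le (by linarith)

/-- Inside the `r`-window the profile is positive. -/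
theorem polyProfile_pos {ℓ : ℝ} {y : T3} (h : Torus.euclidDist y 0 < polyRadius ℓ) :
    0 < polyProfile ℓ y := by
  have h0 : 0 ≤ Torus.euclidDist y 0 := norm_nonneg _
  have : Torus.euclidDist y 0 ^ 2 < polyRadius ℓ ^ 2 := pow_lt_pow_left₀ h h0 two_ne_zero
  exact lt_max_of_lt_left (by linarith)

/-- The mass of the profile is positive. -/
theorem polyMass_pos {ℓ : ℝ} (hℓ : 0 < ℓ) : 0 < polyMass ℓ := by
  unfold polyMass
  rw [integral_pos_iff_support_of_nonneg (fun y => polyProfile_nonneg ℓ y)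
    (integrable_of_continuous_T3 (continuous_polyProfile ℓ))]
  have hsub : {y : T3 | Torus.euclidDist y 0 < polyRadius ℓ} ⊆ support (polyProfile ℓ) :=
    fun y hy => (polyProfile_pos hy).ne'
  refine lt_of_lt_of_le ?_ (measure_mono hsub)
  rw [Torus.volume_euclidDist_lt (polyRadius_lt_half ℓ)]
  exact Metric.measure_ball_pos _ _ (polyRadius_pos hℓ)

/-- The kernel is non-negative. -/
theorem polyKernel_nonneg {ℓ : ℝ} (hℓ : 0 < ℓ) (y : T3) : 0 ≤ polyKernel ℓ y :=
  mul_nonneg (inv_nonneg.2 (polyMass_pos hℓ).le) (polyProfile_nonneg ℓ y)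

/-- The sup bound `k ≤ M⁻¹ r²`. -/
theorem polyKernel_le {ℓ : ℝ} (hℓ : 0 < ℓ) (y : T3) :
    polyKernel ℓ y ≤ (polyMass ℓ)⁻¹ * polyRadius ℓ ^ 2 :=
  mul_le_mul_of_nonneg_left (polyProfile_le ℓ y) (inv_nonneg.2 (polyMass_pos hℓ).le)

/-- The kernel is continuous. -/
theorem continuous_polyKernel (ℓ : ℝ) : Continuous (polyKernel ℓ) :=
  continuous_const.mul (continuous_polyProfile ℓ)

/-- The kernel has mass one. -/
theorem integral_polyKernel {ℓ : ℝ} (hℓ : 0 < ℓ) : ∫ y, polyKernel ℓ y = 1 := by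
  unfold polyKernel
  rw [integral_const_mul]
  exact inv_mul_cancel₀ (polyMass_pos hℓ).ne'

/-- **The polynomial kernel is an admissible mollifier at radius `ℓ`.** -/
theorem isKernel_polyKernel {ℓ : ℝ} (hℓ : 0 < ℓ) : IsKernel ℓ (polyKernel ℓ) := by
  refine ⟨continuous_polyKernel ℓ, polyKernel_nonneg hℓ, integral_polyKernel hℓ, fun y hy => ?_⟩
  have hp : polyProfile ℓ y ≠ 0 := fun h => hy (by rw [polyKernel, h, mul_zero])
  exact (euclidDist_lt_of_polyProfile_ne_zero hℓ hp).trans_le ((polyRadius_le_half ℓ).trans (by linarith))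

/-- **Registered helper stub `exists_isKernel_poly`**: every radius carries an admissible
mollifier (so `MeanFieldsCloseAt → FieldsCloseViaKernelsAt`, and the single-kernel currency is
never vacuous). -/
theorem exists_isKernel_poly : ∀ ℓ : ℝ, 0 < ℓ → ∃ k : T3 → ℝ, IsKernel ℓ k :=
  fun ℓ hℓ => ⟨polyKernel ℓ, isKernel_polyKernel hℓ⟩

/-- An admissible kernel is bounded: `0 ≤ k ≤ C`. -/
theorem IsKernel.exists_forall_le {ℓ : ℝ} {k : T3 → ℝ} (hk : IsKernel ℓ k) :
    ∃ C : ℝ, 0 ≤ C ∧ ∀ y, k y ≤ C := by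
  obtain ⟨C, hC0, hC⟩ := exists_forall_abs_le_of_continuous hk.1
  exact ⟨C, hC0, fun y => (le_abs_self _).trans (hC y)⟩

/-! ### 2. Velocities are almost surely pairwise distinct -/

/-- The velocity-coincidence set `{z | ∃ i ≠ j, vᵢ = vⱼ}` of `n`-particle phase space. -/
def velCoincide (n : ℕ) : Set (Config n (Fin 3) T3) :=
  ⋃ i : Fin n, ⋃ j : Fin n, {w | i ≠ j ∧ (w i).2 = (w j).2}

/-- Membership in the velocity-coincidence set. -/
theorem mem_velCoincide {n : ℕ} {w : Config n (Fin 3) T3} :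
    w ∈ velCoincide n ↔ ∃ i j : Fin n, i ≠ j ∧ (w i).2 = (w j).2 := by
  simp [velCoincide]

/-- One coincidence "hyperplane" `{vᵢ = vⱼ}` is measurable. -/
theorem measurableSet_setOf_vel_eq {n : ℕ} (i j : Fin n) :
    MeasurableSet {w : Config n (Fin 3) T3 | (w i).2 = (w j).2} :=
  measurableSet_eq_fun (measurable_pi_apply i).snd (measurable_pi_apply j).snd

/-- The velocity-coincidence set is measurable. -/
theorem measurableSet_velCoincide (n : ℕ) : MeasurableSet (velCoincide n) := by
  refine MeasurableSet.iUnion fun i => MeasurableSet.iUnion fun j => ?_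
  simp_rw [setOf_and]
  exact (MeasurableSet.const _).inter (measurableSet_setOf_vel_eq i j)

/-- One "hyperplane" `{vᵢ = vⱼ}` (`i ≠ j`) is Lebesgue-null: its sections in the coordinates of
particle `i` are `𝕋³ × {vⱼ}`. -/
theorem volume_setOf_vel_eq {n : ℕ} {i j : Fin n} (hij : i ≠ j) :
    volume {w : Config n (Fin 3) T3 | (w i).2 = (w j).2} = 0 := by
  refine volume_eq_zero_of_sections (measurableSet_setOf_vel_eq i j) i fun z => ?_
  have hsec : {y : T3 × V3 | update z i y ∈ {w : Config n (Fin 3) T3 | (w i).2 = (w j).2}} =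
      (univ : Set T3) ×ˢ {(z j).2} := by
    ext y
    simp [update_of_ne hij.symm]
  rw [hsec, Measure.volume_eq_prod, Measure.prod_prod, measure_singleton, mul_zero]

/-- The velocity-coincidence set is Lebesgue-null. -/
theorem volume_velCoincide (n : ℕ) : volume (velCoincide n) = 0 := by
  refine measure_iUnion_null fun i => measure_iUnion_null fun j => ?_
  by_cases hij : i = j
  · simp [hij]
  · exact measure_mono_null (fun w hw => hw.2) (volume_setOf_vel_eq hij)

/-- … hence Liouville-null for every diameter. -/
theorem liouville_velCoincide (n : ℕ) (ε : ℝ) :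
    liouville (Torus.geometry (Fin 3)) n ε (velCoincide n) = 0 :=
  (Measure.absolutelyContinuous_of_le Measure.restrict_le_self) (volume_velCoincide n)

/-- **Almost surely, at every time the velocities of the flowed configuration are pairwise
distinct** (local Gibbs law `≪` Liouville, flow map Liouville-preserving). -/
theorem ae_localGibbsLaw_vel_ne (σ : ℝ) (a₀ : T3 → ℝ) (u₀ : T3 → V3) (θ₀ : T3 → ℝ) (N : ℕ)
    (Φ : HardSphereFlow (Torus.geometry (Fin 3)) (hsDiameter σ N) (N + 1)) (t : ℝ) :
    ∀ᵐ z ∂(localGibbsLaw σ a₀ u₀ θ₀ N Φ),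
      ∀ i j : Fin (N + 1), i ≠ j → ((Φ.flow t z) i).2 ≠ ((Φ.flow t z) j).2 := by
  have h0 : liouville (Torus.geometry (Fin 3)) (N + 1) (hsDiameter σ N)
      ((Φ.flow t) ⁻¹' velCoincide (N + 1)) = 0 := by
    rw [(Φ.measurePreserving t).measure_preimage (measurableSet_velCoincide _).nullMeasurableSet]
    exact liouville_velCoincide _ _
  have h1 : localGibbsLaw σ a₀ u₀ θ₀ N Φ ((Φ.flow t) ⁻¹' velCoincide (N + 1)) = 0 := by
    rw [localGibbsLaw_eq]
    exact localGibbsMeasure_absolutelyContinuous σ a₀ u₀ θ₀ N Φ h0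
  filter_upwards [compl_mem_ae_iff.2 h1] with z hz i j hij heq
  exact hz (mem_preimage.2 (mem_velCoincide.2 ⟨i, j, hij, heq⟩))

/-! ### 3. The realizable cone of mollified states -/

section Cone

variable {ι : Type*} {W : Type*} [NormedAddCommGroup W] [InnerProductSpace ℝ W]

/-- **Lagrange's identity** for non-negative weights:
`(Σa)(Σa‖v‖²) − ‖Σ a v‖² = ½ ΣᵢΣⱼ aᵢaⱼ‖vᵢ − vⱼ‖²`. -/
theorem sum_mul_sum_sub_norm_sq (s : Finset ι) (a : ι → ℝ) (v : ι → W) :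
    (∑ i ∈ s, a i) * (∑ i ∈ s, a i * ‖v i‖ ^ 2) - ‖∑ i ∈ s, a i • v i‖ ^ 2 =
      2⁻¹ * ∑ i ∈ s, ∑ j ∈ s, a i * a j * ‖v i - v j‖ ^ 2 := by
  have h1 : ‖∑ i ∈ s, a i • v i‖ ^ 2 = ∑ i ∈ s, ∑ j ∈ s, a i * a j * ⟪v i, v j⟫_ℝ := by
    rw [← real_inner_self_eq_norm_sq, sum_inner]
    refine Finset.sum_congr rfl fun i _ => ?_
    rw [inner_sum]
    refine Finset.sum_congr rfl fun j _ => ?_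
    rw [real_inner_smul_left, real_inner_smul_right]; ring
  have h2 : ∑ i ∈ s, ∑ j ∈ s, a i * a j * ‖v i - v j‖ ^ 2 =
      ∑ i ∈ s, ∑ j ∈ s, (a i * ‖v i‖ ^ 2 * a j + a i * (a j * ‖v j‖ ^ 2) -
        2 * (a i * a j * ⟪v i, v j⟫_ℝ)) := by
    refine Finset.sum_congr rfl fun i _ => Finset.sum_congr rfl fun j _ => ?_
    rw [norm_sub_sq_real]; ring
  rw [h2, h1]
  simp only [Finset.sum_sub_distrib, Finset.sum_add_distrib, ← Finset.mul_sum, ← Finset.sum_mul]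
  ring

/-- **Weighted Cauchy–Schwarz**: `‖Σ aᵢvᵢ‖² ≤ (Σ aᵢ)(Σ aᵢ‖vᵢ‖²)` for `aᵢ ≥ 0`. -/
theorem norm_sum_smul_sq_le (s : Finset ι) {a : ι → ℝ} (ha : ∀ i ∈ s, 0 ≤ a i) (v : ι → W) :
    ‖∑ i ∈ s, a i • v i‖ ^ 2 ≤ (∑ i ∈ s, a i) * (∑ i ∈ s, a i * ‖v i‖ ^ 2) := by
  have h := sum_mul_sum_sub_norm_sq s a v
  have hnn : 0 ≤ ∑ i ∈ s, ∑ j ∈ s, a i * a j * ‖v i - v j‖ ^ 2 :=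
    Finset.sum_nonneg fun i hi => Finset.sum_nonneg fun j hj =>
      mul_nonneg (mul_nonneg (ha i hi) (ha j hj)) (sq_nonneg _)
  linarith

/-- **Strict weighted Cauchy–Schwarz**: strict as soon as two indices carry positive weight and
different vectors. -/
theorem norm_sum_smul_sq_lt (s : Finset ι) {a : ι → ℝ} (ha : ∀ i ∈ s, 0 ≤ a i) (v : ι → W)
    {i j : ι} (hi : i ∈ s) (hj : j ∈ s) (hai : 0 < a i) (haj : 0 < a j) (hv : v i ≠ v j) :
    ‖∑ i ∈ s, a i • v i‖ ^ 2 < (∑ i ∈ s, a i) * (∑ i ∈ s, a i * ‖v i‖ ^ 2) := by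
  have h := sum_mul_sum_sub_norm_sq s a v
  have hterm : 0 < a i * a j * ‖v i - v j‖ ^ 2 :=
    mul_pos (mul_pos hai haj) (pow_pos (norm_pos_iff.2 (sub_ne_zero.2 hv)) 2)
  have hnn : ∀ i' ∈ s, ∀ j' ∈ s, 0 ≤ a i' * a j' * ‖v i' - v j'‖ ^ 2 := fun i' hi' j' hj' =>
    mul_nonneg (mul_nonneg (ha i' hi') (ha j' hj')) (sq_nonneg _)
  have hin : a i * a j * ‖v i - v j‖ ^ 2 ≤ ∑ j' ∈ s, a i * a j' * ‖v i - v j'‖ ^ 2 :=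
    Finset.single_le_sum (f := fun j' => a i * a j' * ‖v i - v j'‖ ^ 2) (fun j' hj' => hnn i hi j' hj') hj
  have hout : ∑ j' ∈ s, a i * a j' * ‖v i - v j'‖ ^ 2 ≤
      ∑ i' ∈ s, ∑ j' ∈ s, a i' * a j' * ‖v i' - v j'‖ ^ 2 :=
    Finset.single_le_sum (f := fun i' => ∑ j' ∈ s, a i' * a j' * ‖v i' - v j'‖ ^ 2)
      (fun i' hi' => Finset.sum_nonneg fun j' hj' => hnn i' hi' j' hj') hi
  linarith

end Cone

variable {n : ℕ} {k : T3 → ℝ} {C : ℝ}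

/-- The mollified density in terms of the window weights `aᵢ = k(x − xᵢ)`. -/
theorem mollState_fst_eq (k : T3 → ℝ) (z : Config n (Fin 3) T3) (x : T3) :
    (mollState k z x).1 = (n : ℝ)⁻¹ * ∑ i, k (x - (z i).1) := by
  rw [mollState_fst, empiricalDensityField_eq_sum]

/-- The mollified momentum in terms of the window weights. -/
theorem mollState_snd_fst_eq (k : T3 → ℝ) (z : Config n (Fin 3) T3) (x : T3) :
    (mollState k z x).2.1 = (n : ℝ)⁻¹ • ∑ i, k (x - (z i).1) • (z i).2 := by
  rw [mollState_snd_fst, empiricalMomentumField_eq_sum]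

/-- The mollified energy in terms of the window weights. -/
theorem mollState_snd_snd_eq (k : T3 → ℝ) (z : Config n (Fin 3) T3) (x : T3) :
    (mollState k z x).2.2 = (n : ℝ)⁻¹ * ∑ i, k (x - (z i).1) * (‖(z i).2‖ ^ 2 / 2) := by
  rw [mollState_snd_snd, empiricalEnergyField_eq_sum]

/-- `ρ^k ≥ 0` for a non-negative kernel. -/
theorem mollState_fst_nonneg (hk0 : ∀ y, 0 ≤ k y) (z : Config n (Fin 3) T3) (x : T3) :
    0 ≤ (mollState k z x).1 := by
  rw [mollState_fst_eq]
  exact mul_nonneg (inv_nonneg.2 (Nat.cast_nonneg n)) (Finset.sum_nonneg fun i _ => hk0 _)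

/-- `E^k ≥ 0` for a non-negative kernel. -/
theorem mollState_snd_snd_nonneg (hk0 : ∀ y, 0 ≤ k y) (z : Config n (Fin 3) T3) (x : T3) :
    0 ≤ (mollState k z x).2.2 := by
  rw [mollState_snd_snd_eq]
  exact mul_nonneg (inv_nonneg.2 (Nat.cast_nonneg n))
    (Finset.sum_nonneg fun i _ => mul_nonneg (hk0 _) (by positivity))

/-- `ρ^k ≤ sup k` for a kernel `0 ≤ k ≤ C` (an average of window weights). -/
theorem mollState_fst_le (hk0 : ∀ y, 0 ≤ k y) (hkC : ∀ y, k y ≤ C) (z : Config n (Fin 3) T3)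
    (x : T3) : (mollState k z x).1 ≤ C := by
  have hC : 0 ≤ C := (hk0 0).trans (hkC 0)
  rw [mollState_fst_eq]
  rcases Nat.eq_zero_or_pos n with hn | hn
  · subst hn; simp [hC]
  have hn' : (0 : ℝ) < n := by exact_mod_cast hn
  calc (n : ℝ)⁻¹ * ∑ i, k (x - (z i).1) ≤ (n : ℝ)⁻¹ * ∑ _i : Fin n, C := by
        gcongr with i
        exact hkC _
    _ = C := by rw [Finset.sum_const, Finset.card_univ, Fintype.card_fin, nsmul_eq_mul]; field_simp

/-- **The mollified state lies in the realizable cone**: `‖m^k‖² ≤ 2 ρ^k E^k` (`k ≥ 0`). -/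
theorem mollState_norm_sq_le (hk0 : ∀ y, 0 ≤ k y) (z : Config n (Fin 3) T3) (x : T3) :
    ‖(mollState k z x).2.1‖ ^ 2 ≤ 2 * (mollState k z x).1 * (mollState k z x).2.2 := by
  rw [mollState_fst_eq, mollState_snd_fst_eq, mollState_snd_snd_eq, norm_smul, mul_pow,
    Real.norm_of_nonneg (inv_nonneg.2 (Nat.cast_nonneg n))]
  have hcs := norm_sum_smul_sq_le Finset.univ (fun i _ => hk0 (x - (z i).1)) (fun i => (z i).2)
  have he : ∑ i, k (x - (z i).1) * (‖(z i).2‖ ^ 2 / 2) = 2⁻¹ * ∑ i, k (x - (z i).1) * ‖(z i).2‖ ^ 2 := by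
    rw [Finset.mul_sum]; exact Finset.sum_congr rfl fun i _ => by ring
  rw [he]
  have hn : 0 ≤ ((n : ℝ)⁻¹) ^ 2 := sq_nonneg _
  calc (n : ℝ)⁻¹ ^ 2 * ‖∑ i, k (x - (z i).1) • (z i).2‖ ^ 2
      ≤ (n : ℝ)⁻¹ ^ 2 * ((∑ i, k (x - (z i).1)) * ∑ i, k (x - (z i).1) * ‖(z i).2‖ ^ 2) :=
        mul_le_mul_of_nonneg_left hcs hn
    _ = _ := by ring

/-- **Trichotomy off the coincidence set.** If the velocities of `z` are pairwise distinct and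
`0 ≤ k ≤ C`, then every mollified state is PHYSICAL (`‖m^k‖² < 2ρ^kE^k`: at least two particles
in the window) or carries at most one particle (`ρ^k ≤ C / n`; this covers the empty window). -/
theorem mollState_physical_or_fst_le (hk0 : ∀ y, 0 ≤ k y) (hkC : ∀ y, k y ≤ C)
    {z : Config n (Fin 3) T3} (hz : ∀ i j : Fin n, i ≠ j → (z i).2 ≠ (z j).2) (x : T3) :
    ‖(mollState k z x).2.1‖ ^ 2 < 2 * (mollState k z x).1 * (mollState k z x).2.2 ∨
      (mollState k z x).1 ≤ C / n := by
  have hC : 0 ≤ C := (hk0 0).trans (hkC 0)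
  by_cases htwo : ∃ i j : Fin n, i ≠ j ∧ k (x - (z i).1) ≠ 0 ∧ k (x - (z j).1) ≠ 0
  · left
    obtain ⟨i, j, hij, hi, hj⟩ := htwo
    rw [mollState_fst_eq, mollState_snd_fst_eq, mollState_snd_snd_eq, norm_smul, mul_pow,
      Real.norm_of_nonneg (inv_nonneg.2 (Nat.cast_nonneg n))]
    have hcs := norm_sum_smul_sq_lt Finset.univ (fun i _ => hk0 (x - (z i).1)) (fun i => (z i).2)
      (Finset.mem_univ i) (Finset.mem_univ j) ((hk0 _).lt_of_ne' hi) ((hk0 _).lt_of_ne' hj)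
      (hz i j hij)
    have he : ∑ i, k (x - (z i).1) * (‖(z i).2‖ ^ 2 / 2) =
        2⁻¹ * ∑ i, k (x - (z i).1) * ‖(z i).2‖ ^ 2 := by
      rw [Finset.mul_sum]; exact Finset.sum_congr rfl fun i _ => by ring
    rw [he]
    have hn0 : n ≠ 0 := by rintro rfl; exact Fin.elim0 i
    have hn : 0 < ((n : ℝ)⁻¹) ^ 2 := by positivity
    calc (n : ℝ)⁻¹ ^ 2 * ‖∑ i, k (x - (z i).1) • (z i).2‖ ^ 2
        < (n : ℝ)⁻¹ ^ 2 * ((∑ i, k (x - (z i).1)) * ∑ i, k (x - (z i).1) * ‖(z i).2‖ ^ 2) :=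
          mul_lt_mul_of_pos_left hcs hn
      _ = _ := by ring
  · right
    push Not at htwo
    rw [mollState_fst_eq, div_eq_inv_mul]
    refine mul_le_mul_of_nonneg_left ?_ (inv_nonneg.2 (Nat.cast_nonneg n))
    by_cases hone : ∃ i : Fin n, k (x - (z i).1) ≠ 0
    · obtain ⟨i, hi⟩ := hone
      rw [Finset.sum_eq_single i (fun j _ hji => ?_) (fun h => (h (Finset.mem_univ i)).elim)]
      · exact hkC _
      · by_contra hj
        exact hi (htwo j i hji hj)
    · push Not at hone
      rw [Finset.sum_eq_zero fun i _ => hone i]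
      exact hC

/-! ### 4. The registered helper stub bundling toolbox A -/

/-- **Registered helper stub `s3bKernelConeToolbox`** (crux stmt-AtomisticToContinuum-9258, line
`registered`; currency-independent toolbox of step S3b): (1) every radius carries an admissible
mollifier, (1') namely the polynomial kernel, with its sup bound; (1'') admissible kernels are
bounded; (2) under the local Gibbs law the flowed velocities are a.s. pairwise distinct at every
time; (3) for a kernel `0 ≤ k ≤ C` every mollified state lies in the realizable cone
`{0 ≤ ρ ≤ C, 0 ≤ E, ‖m‖² ≤ 2ρE}` and, off the velocity-coincidence set, is physical or carries at
most one particle (`ρ ≤ C/n`). -/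
def Sig.s3bKernelConeToolbox : Prop :=
  (∀ ℓ : ℝ, 0 < ℓ → ∃ k : T3 → ℝ, IsKernel ℓ k) ∧
  (∀ ℓ : ℝ, 0 < ℓ → IsKernel ℓ (polyKernel ℓ) ∧
      ∀ y, polyKernel ℓ y ≤ (polyMass ℓ)⁻¹ * polyRadius ℓ ^ 2) ∧
  (∀ (ℓ : ℝ) (k : T3 → ℝ), IsKernel ℓ k → ∃ C : ℝ, 0 ≤ C ∧ ∀ y, k y ≤ C) ∧
  (∀ (σ : ℝ) (a₀ : T3 → ℝ) (u₀ : T3 → V3) (θ₀ : T3 → ℝ) (N : ℕ)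
      (Φ : HardSphereFlow (Literature.Analysis.FluidPDE.Torus.geometry (Fin 3)) (hsDiameter σ N) (N + 1))
      (t : ℝ), ∀ᵐ z ∂(localGibbsLaw σ a₀ u₀ θ₀ N Φ),
        ∀ i j : Fin (N + 1), i ≠ j → ((Φ.flow t z) i).2 ≠ ((Φ.flow t z) j).2) ∧
  (∀ (n : ℕ) (k : T3 → ℝ) (C : ℝ), (∀ y, 0 ≤ k y) → (∀ y, k y ≤ C) →
      ∀ z : Config n (Fin 3) T3, (∀ i j : Fin n, i ≠ j → (z i).2 ≠ (z j).2) → ∀ x : T3,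
        0 ≤ (mollState k z x).1 ∧ (mollState k z x).1 ≤ C ∧ 0 ≤ (mollState k z x).2.2 ∧
        ‖(mollState k z x).2.1‖ ^ 2 ≤ 2 * (mollState k z x).1 * (mollState k z x).2.2 ∧
        (‖(mollState k z x).2.1‖ ^ 2 < 2 * (mollState k z x).1 * (mollState k z x).2.2 ∨
          (mollState k z x).1 ≤ C / n))

/-- **Proof of the registered helper stub `s3bKernelConeToolbox`.** -/
theorem s3bKernelConeToolbox : Sig.s3bKernelConeToolbox :=
  ⟨exists_isKernel_poly, fun _ℓ hℓ => ⟨isKernel_polyKernel hℓ, polyKernel_le hℓ⟩,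
    fun _ℓ _k hk => hk.exists_forall_le, ae_localGibbsLaw_vel_ne,
    fun _n _k _C hk0 hkC z hz x =>
      ⟨mollState_fst_nonneg hk0 z x, mollState_fst_le hk0 hkC z x, mollState_snd_snd_nonneg hk0 z x,
        mollState_norm_sq_le hk0 z x, mollState_physical_or_fst_le hk0 hkC hz x⟩⟩

end Summit.AtomisticToContinuum.HydrodynamicLimit.Theorems.AWS

end
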